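import Mathlib
import HarnessLib
import Summits.RiemannHypothesis.RiemannHypothesis.Theorems.EarlyAppointmentsRemainder0XiEtaLedgerArith
import Summits.RiemannHypothesis.RiemannHypothesis.Theorems.EarlyAppointmentsRemainder0XiKernelShiftNumerics

/-!
# ⟨24730⟩ ρ2 v4 — LEAF 2 (`AbelMainLeaf`): the CLOSED NUMERIC INEQUALITY `leaf2Bound x δ ≤ 0.03105 · log(γ/2π) + 0.03`

C4 «kernel desk» rh-idea-6 g31, director (CA406)(d)/(CA419); constants priced by C3 g41 (RESULT-17, table `K4C`:
`a = 3105/100000`, `b = 3/100`).  SUPPORT module for crux r3 `Remainder0Xi` (stmt-RiemannHypothesis-24730), line `rho2_v4`,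
stub `stub_farAbel4`, leaf `AbelMainLeaf` of …FarAbelSkeleton.  Fully proved, standard axioms; imports: Mathlib, HarnessLib,
the LANDED tree module `…EtaLedgerArith` (`T_PT = 3000175332800`, `boxHalfWidth = 135/2`) and the leaf-1 numerics module
`…KernelShiftNumerics` (row 17: `div_twoPi_le`, `envelope_le`; through it the tree's `RegistryForm.log_div_twoPi_ge`) only.

LEAF 2 compares the far height sum `Σ_far m_ρ · 2x/(x² − (Re ρ)²)` (truncated at height `T`, eventually in `T`) with the
main integral `(1/2π)(∫_{14}^{x−67.5} + ∫_{x+67.5}^{∞}) log(t/2π) · 2x/(x² − t²) dt`.  …AbelMainLeafClose bounds the difference by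
the explicit real number `leaf2Bound x δ` below, where `δ ∈ (0, 1/100]` is the free downward shift of the upper Abel start
`T₀ = x + 67.5 − δ` into a zero-free sliver (so that the closed edge `Re ρ = x + 67.5` of the far box needs no counting device):
* lower Abel/HSW side (…AbelLowSide `lowHalf_bound`): envelope `W(x − 67.5)` against `2φ↓(x − 67.5) = 4x/(67.5(2x − 67.5))`,
  plus the `(0,14]` piece `≤ 10⁻⁹`;
* upper BPT side (…AbelHighSide `abs_Fup_le`, `integral_phiUp_div_le`): `2 W(T₀) φ↑(T₀)` with `φ↑(T₀) = 2x/(T₀² − x²) ≤ 1/67.49`,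
  and the tail `(0.1038 + 0.2573/log T₀) · 4√T₀/x ≤ 0.3611 · 5·10⁻⁶`;
* the sliver `∫_{T₀}^{x+67.5} φ↑ log(t/2π) dt /(2π) ≤ φ↑(T₀) · log((x+67.5)/2π) · δ/(2π)`.
With `W(s) ≤ 0.11184063·M + 11.0838393` (`M = log((x+67.5)/2π) ≤ L + 10⁻¹⁰`, `L = log(γ/2π) ≥ 26`) the total is
`≤ 0.0066517·M + 0.656870 ≤ 0.03105·L + 0.03` (at `L = 26`: `0.82981 ≤ 0.8373`).
* ★ `leaf2Bound_le (hγ : T_PT < γ) (hx : |x − γ| ≤ boxHalfWidth) (hδ0 : 0 < δ) (hδ : δ ≤ 1/100) :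
  leaf2Bound x δ ≤ 3105/100000 · log(γ/2π) + 3/100`.
Nothing here bears on the truth of RH; RH is not proved; 24730 OPEN.
-/

noncomputable section

set_option linter.dupNamespace false

namespace Summit.RiemannHypothesis.RiemannHypothesis.Theorems.EarlyAppointmentsRemainder0Xi.AbelMainNumerics

open Real
open Summit.RiemannHypothesis.RiemannHypothesis.Cruxes.Remainder0Xi.Rho2V2 (T_PT boxHalfWidth)
open Summit.RiemannHypothesis.RiemannHypothesis.Theorems.EarlyAppointmentsRemainder0Xi.KernelShiftNumerics
  (div_twoPi_le envelope_le)

/-- ★ The explicit LEAF-2 majorant at the real point `x` (box `|x − γ| ≤ 67.5`) with sliver width `δ ∈ (0, 1/100]`,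
written in exactly the syntactic shape the analytic lemmas of …AbelMainLeafClose produce. -/
def leaf2Bound (x δ : ℝ) : ℝ :=
  ((0.1038 * Real.log (x - boxHalfWidth) + 0.2573 * Real.log (Real.log (x - boxHalfWidth)) + 10.2425)
      * (2 * (2 * x / (x ^ 2 - (x - boxHalfWidth) ^ 2))) + 1 / 10 ^ 9)
  + (2 * (0.1038 * Real.log (x + boxHalfWidth - δ) + 0.2573 * Real.log (Real.log (x + boxHalfWidth - δ)) + 10.2425)
        * (2 * x / ((x + boxHalfWidth - δ) ^ 2 - x ^ 2))
      + (0.1038 + 0.2573 / Real.log (x + boxHalfWidth - δ)) * (4 * Real.sqrt (x + boxHalfWidth - δ) / x))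
  + 2 * x / ((x + boxHalfWidth - δ) ^ 2 - x ^ 2) * Real.log ((x + boxHalfWidth) / (2 * Real.pi)) * δ / (2 * Real.pi)

/-- `log(t/2π) ≤ log(γ/2π) + 10⁻¹⁰` for `0 < t ≤ γ + 135`, `γ > T_PT` (since `log(t/γ) ≤ t/γ − 1 ≤ 135/γ`). -/
theorem log_shift_le135 {γ t : ℝ} (hγ : T_PT < γ) (ht0 : 0 < t) (htγ : t ≤ γ + 135) :
    Real.log (t / (2 * π)) ≤ Real.log (γ / (2 * π)) + 1 / 10 ^ 10 := by
  have hγ' : (3000175332800 : ℝ) < γ := hγ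
  have h2π0 : 0 < 2 * π := by positivity
  have hγ0 : 0 < γ := by linarith
  have e : Real.log (t / (2 * π)) - Real.log (γ / (2 * π)) = Real.log (t / γ) := by
    rw [Real.log_div ht0.ne' h2π0.ne', Real.log_div hγ0.ne' h2π0.ne', Real.log_div ht0.ne' hγ0.ne']
    ring
  have h1 : Real.log (t / γ) ≤ t / γ - 1 := Real.log_le_sub_one_of_pos (by positivity)
  have h2 : t / γ - 1 ≤ 1 / 10 ^ 10 := by
    rw [div_sub_one hγ0.ne', div_le_div_iff₀ hγ0 (by norm_num)]
    linarith
  linarith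

/-- Lower coefficient: `2 φ↓(x − 67.5) = 4x/(x² − (x − 67.5)²) = 4x/(135x − 67.5²) ≤ 4/135 + 10⁻¹²` for `x ≥ 2·10¹²`. -/
theorem kLow_le {x : ℝ} (hx : 2000000000000 ≤ x) :
    2 * (2 * x / (x ^ 2 - (x - boxHalfWidth) ^ 2)) ≤ 4 / 135 + 1 / 10 ^ 12 := by
  have hB : boxHalfWidth = 135 / 2 := rfl
  rw [hB]
  have hD : 0 < x ^ 2 - (x - 135 / 2) ^ 2 := by nlinarith
  rw [show 2 * (2 * x / (x ^ 2 - (x - 135 / 2) ^ 2)) = 4 * x / (x ^ 2 - (x - 135 / 2) ^ 2) by ring,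
    div_le_iff₀ hD]
  nlinarith

/-- The low-side coefficient `2·(2x/(x² − (x − boxHalfWidth)²))` is nonnegative for large `x`. -/
theorem kLow_nonneg {x : ℝ} (hx : 2000000000000 ≤ x) :
    0 ≤ 2 * (2 * x / (x ^ 2 - (x - boxHalfWidth) ^ 2)) := by
  have hB : boxHalfWidth = 135 / 2 := rfl
  rw [hB]
  have hD : 0 < x ^ 2 - (x - 135 / 2) ^ 2 := by nlinarith
  positivity

/-- Upper coefficient: `φ↑(T₀) = 2x/(T₀² − x²) ≤ 1/(67.5 − δ) ≤ 100/6749` at `T₀ = x + 67.5 − δ`, `0 < δ ≤ 1/100`. -/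
theorem kUp_pos_den {x δ : ℝ} (hx : 0 < x) (hδ : δ ≤ 1 / 100) :
    0 < (x + boxHalfWidth - δ) ^ 2 - x ^ 2 := by
  have hB : boxHalfWidth = 135 / 2 := rfl
  rw [hB]
  nlinarith [mul_nonneg hx.le (show (0:ℝ) ≤ 135 / 2 - δ by linarith)]

/-- The high-side coefficient `2x/((x + boxHalfWidth − δ)² − x²)` is at most `100/6749` for `0 < x`, `δ ≤ 1/100`. -/
theorem kUp_le {x δ : ℝ} (hx : 0 < x) (hδ : δ ≤ 1 / 100) :
    2 * x / ((x + boxHalfWidth - δ) ^ 2 - x ^ 2) ≤ 100 / 6749 := by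
  have hD := kUp_pos_den hx hδ
  have hB : boxHalfWidth = 135 / 2 := rfl
  rw [hB] at hD ⊢
  rw [div_le_iff₀ hD]
  nlinarith [mul_nonneg hx.le (sub_nonneg.2 hδ), sq_nonneg (135 / 2 - δ)]

/-- The high-side coefficient `2x/((x + boxHalfWidth − δ)² − x²)` is nonnegative for `0 < x`, `δ ≤ 1/100`. -/
theorem kUp_nonneg {x δ : ℝ} (hx : 0 < x) (hδ : δ ≤ 1 / 100) :
    0 ≤ 2 * x / ((x + boxHalfWidth - δ) ^ 2 - x ^ 2) :=
  div_nonneg (by linarith) (kUp_pos_den hx hδ).le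

/-- The BPT tail coefficient: `0.1038 + 0.2573/log s ≤ 0.3611` and `≥ 0` for `s ≥ 3`. -/
theorem coef_le {s : ℝ} (hs : 3 ≤ s) : 0.1038 + 0.2573 / Real.log s ≤ 0.3611 := by
  have hs0 : 0 < s := by linarith
  have hlog1 : 1 ≤ Real.log s := by
    rw [Real.le_log_iff_exp_le hs0]
    linarith [Real.exp_one_lt_d9]
  have : 0.2573 / Real.log s ≤ 0.2573 := div_le_self (by norm_num) hlog1
  linarith

/-- `0.1038 + 0.2573/log s ≥ 0` for `s ≥ 3`. -/
theorem coef_nonneg {s : ℝ} (hs : 3 ≤ s) : 0 ≤ 0.1038 + 0.2573 / Real.log s := by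
  have hlog0 : 0 ≤ Real.log s := Real.log_nonneg (by linarith)
  positivity

/-- The `∫ φ↑/t` tail: `4√s/x ≤ 5·10⁻⁶` for `10¹² ≤ x ≤ s ≤ x + 68` (`√s ≤ s/10⁶`). -/
theorem tail_le2 {x s : ℝ} (hx : 1000000000000 ≤ x) (hxs : x ≤ s) (hs : s ≤ x + 68) :
    4 * Real.sqrt s / x ≤ 5 / 10 ^ 6 := by
  have hx0 : 0 < x := by linarith
  have hs0 : 0 ≤ s := by linarith
  have hsq : Real.sqrt s ≤ s / 10 ^ 6 := by
    rw [Real.sqrt_le_left (by positivity)]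
    nlinarith
  rw [div_le_iff₀ hx0]
  nlinarith

/-- `4·√s/x ≥ 0` for `0 < x`. -/
theorem tail_nonneg {x s : ℝ} (hx : 0 < x) : 0 ≤ 4 * Real.sqrt s / x := by positivity

/-- ★ (K) **THE NUMERIC LEAF-2 INEQUALITY**: for `γ > T_PT`, `|x − γ| ≤ 67.5` and `0 < δ ≤ 1/100`,
`leaf2Bound x δ ≤ (3105/100000)·log(γ/2π) + 3/100`. -/
theorem leaf2Bound_le {γ x δ : ℝ} (hγ : T_PT < γ) (hx : |x - γ| ≤ boxHalfWidth) (hδ0 : 0 < δ) (hδ : δ ≤ 1 / 100) :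
    leaf2Bound x δ ≤ 3105 / 100000 * Real.log (γ / (2 * Real.pi)) + 3 / 100 := by
  have hT : T_PT = 3000175332800 := rfl
  have hB : boxHalfWidth = 135 / 2 := rfl
  have hγ' : (3000175332800 : ℝ) < γ := hγ
  obtain ⟨hx1, hx2⟩ := abs_le.1 hx
  rw [hB] at hx1 hx2
  have hx0 : 0 < x := by linarith
  have hx12 : 1000000000000 ≤ x := by linarith
  have hx212 : 2000000000000 ≤ x := by linarith
  have he : Real.exp 1 < 2.7182818286 := Real.exp_one_lt_d9
  -- the points `b = x − 67.5 ≤ s = x + 67.5 − δ ≤ a = x + 67.5`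
  have heb : Real.exp 1 ≤ x - boxHalfWidth := by rw [hB]; linarith
  have hba : x - boxHalfWidth ≤ x + boxHalfWidth := by rw [hB]; linarith
  have hes : Real.exp 1 ≤ x + boxHalfWidth - δ := by rw [hB]; linarith
  have hsa : x + boxHalfWidth - δ ≤ x + boxHalfWidth := by linarith
  have h3s : 3 ≤ x + boxHalfWidth - δ := by rw [hB]; linarith
  have hxs : x ≤ x + boxHalfWidth - δ := by rw [hB]; linarith
  have hs68 : x + boxHalfWidth - δ ≤ x + 68 := by rw [hB]; linarith
  have ha0 : 0 < x + boxHalfWidth := by rw [hB]; linarith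
  have haγ : x + boxHalfWidth ≤ γ + 135 := by rw [hB]; linarith
  -- logs: `M = log((x+67.5)/2π) ≤ L + 10⁻¹⁰`, `L = log(γ/2π) ≥ 26`
  have hL26 : 26 ≤ Real.log (γ / (2 * Real.pi)) := RegistryForm.log_div_twoPi_ge hγ
  have hML : Real.log ((x + boxHalfWidth) / (2 * Real.pi)) ≤ Real.log (γ / (2 * Real.pi)) + 1 / 10 ^ 10 :=
    log_shift_le135 hγ ha0 haγ
  have hM0 : 0 ≤ Real.log ((x + boxHalfWidth) / (2 * Real.pi)) := by
    apply Real.log_nonneg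
    rw [le_div_iff₀ (by positivity), hB]
    linarith [Real.pi_lt_four]
  -- envelopes
  have hWb := envelope_le heb hba
  have hWs := envelope_le hes hsa
  have hWaff0 : 0 ≤ 0.1038 * (Real.log ((x + boxHalfWidth) / (2 * Real.pi)) + 1.85)
      + 0.2573 * (2.465736 + (Real.log ((x + boxHalfWidth) / (2 * Real.pi)) + 1.85) / 32) + 10.2425 := by positivity
  -- coefficients
  have hkL : 2 * (2 * x / (x ^ 2 - (x - boxHalfWidth) ^ 2)) ≤ 4 / 135 + 1 / 10 ^ 12 := kLow_le hx212
  have hkL0 : 0 ≤ 2 * (2 * x / (x ^ 2 - (x - boxHalfWidth) ^ 2)) := kLow_nonneg hx212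
  have hkU : 2 * x / ((x + boxHalfWidth - δ) ^ 2 - x ^ 2) ≤ 100 / 6749 := kUp_le hx0 hδ
  have hkU0 : 0 ≤ 2 * x / ((x + boxHalfWidth - δ) ^ 2 - x ^ 2) := kUp_nonneg hx0 hδ
  have hcf : 0.1038 + 0.2573 / Real.log (x + boxHalfWidth - δ) ≤ 0.3611 := coef_le h3s
  have hcf0 : 0 ≤ 0.1038 + 0.2573 / Real.log (x + boxHalfWidth - δ) := coef_nonneg h3s
  have htl : 4 * Real.sqrt (x + boxHalfWidth - δ) / x ≤ 5 / 10 ^ 6 := tail_le2 hx12 hxs hs68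
  have htl0 : 0 ≤ 4 * Real.sqrt (x + boxHalfWidth - δ) / x := tail_nonneg hx0
  -- products
  have p1 : (0.1038 * Real.log (x - boxHalfWidth) + 0.2573 * Real.log (Real.log (x - boxHalfWidth)) + 10.2425)
        * (2 * (2 * x / (x ^ 2 - (x - boxHalfWidth) ^ 2)))
      ≤ (0.1038 * (Real.log ((x + boxHalfWidth) / (2 * Real.pi)) + 1.85)
        + 0.2573 * (2.465736 + (Real.log ((x + boxHalfWidth) / (2 * Real.pi)) + 1.85) / 32) + 10.2425)
        * (4 / 135 + 1 / 10 ^ 12) :=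
    mul_le_mul hWb hkL hkL0 hWaff0
  have p2 : 2 * (0.1038 * Real.log (x + boxHalfWidth - δ) + 0.2573 * Real.log (Real.log (x + boxHalfWidth - δ)) + 10.2425)
        * (2 * x / ((x + boxHalfWidth - δ) ^ 2 - x ^ 2))
      ≤ 2 * (0.1038 * (Real.log ((x + boxHalfWidth) / (2 * Real.pi)) + 1.85)
        + 0.2573 * (2.465736 + (Real.log ((x + boxHalfWidth) / (2 * Real.pi)) + 1.85) / 32) + 10.2425) * (100 / 6749) :=
    mul_le_mul (by linarith) hkU hkU0 (by linarith)
  have p3 : (0.1038 + 0.2573 / Real.log (x + boxHalfWidth - δ)) * (4 * Real.sqrt (x + boxHalfWidth - δ) / x)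
      ≤ 0.3611 * (5 / 10 ^ 6) :=
    mul_le_mul hcf htl htl0 (by norm_num)
  have p4a : 2 * x / ((x + boxHalfWidth - δ) ^ 2 - x ^ 2) * Real.log ((x + boxHalfWidth) / (2 * Real.pi))
      ≤ 100 / 6749 * Real.log ((x + boxHalfWidth) / (2 * Real.pi)) := mul_le_mul_of_nonneg_right hkU hM0
  have p4b : 2 * x / ((x + boxHalfWidth - δ) ^ 2 - x ^ 2) * Real.log ((x + boxHalfWidth) / (2 * Real.pi)) * δ
      ≤ 100 / 6749 * Real.log ((x + boxHalfWidth) / (2 * Real.pi)) * (1 / 100) :=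
    mul_le_mul p4a hδ hδ0.le (by positivity)
  have p4c : 2 * x / ((x + boxHalfWidth - δ) ^ 2 - x ^ 2) * Real.log ((x + boxHalfWidth) / (2 * Real.pi)) * δ / (2 * Real.pi)
      ≤ 2 * x / ((x + boxHalfWidth - δ) ^ 2 - x ^ 2) * Real.log ((x + boxHalfWidth) / (2 * Real.pi)) * δ * 0.15916 :=
    div_twoPi_le (by positivity)
  have p4d : 2 * x / ((x + boxHalfWidth - δ) ^ 2 - x ^ 2) * Real.log ((x + boxHalfWidth) / (2 * Real.pi)) * δ * 0.15916
      ≤ 100 / 6749 * Real.log ((x + boxHalfWidth) / (2 * Real.pi)) * (1 / 100) * 0.15916 :=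
    mul_le_mul_of_nonneg_right p4b (by norm_num)
  -- total
  unfold leaf2Bound
  linarith

end Summit.RiemannHypothesis.RiemannHypothesis.Theorems.EarlyAppointmentsRemainder0Xi.AbelMainNumerics

end
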